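import Summits.AtomisticToContinuum.BoseEinsteinCondensation.Theorems.BECGroundStateSOSPeriodicIRBoundTwoSectorLowDefs
import Summits.AtomisticToContinuum.BoseEinsteinCondensation.Theorems.BECGroundStateSOSPeriodicIRBoundTwoSectorAeZeroFloating
import HarnessLib

/-!
# Route `BECGroundStateSOS`, crux `PeriodicIRBound` (stmt-AtomisticToContinuum-3972), line `two-sector-gd-transfer` —
# v11 Defs ("pointwise floating + soft location"): the per-state floating bound S1₁ and the stubs of the EQUIVALENCE
# `S1₁ ⟺ X_int`

Fourth `Defs` module of the line (after `…TwoSectorDefs` p137770, `…TwoSectorFloatingDefs` p152359, `…TwoSectorZeroDefs`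
p158945 / `…TwoSectorLowDefs` p159540), lead seat c23, `Cruxes/PeriodicIRBound/SOFT-LOCATION.md`.

**The finding (SOFT-LOCATION.md).** For an integrable admissible `v` with `∫v > 0`, the crux's infrared inequality
`IRBoundFor v` (= X(v)) IMPLIES the floating two-channel Kennedy–Lieb–Shastry bound of v9/v10 provided the common chemical
potential `μ` is allowed to depend on the near-minimiser `Ψ` — and that per-state form still implies X(v), because the
KLS endgame (`KLS.real_core`, `WindowArithLow.nk_le`) is run state by state. Paper proof: a free `μ` turns the two shares
into ONE inequality `nF + M ≥ n(n+1)(2n+1)/b`; the hole share is variational (`M ≥ −μ⁻n`); Born's bound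
`μ⁻ ≤ (N−1)‖v‖₁/L³` cancels the direct term of the two-sided f-sum identity (`WF.kinetic_wagnerFeynman`,
`WF.potForm_modeCr`, `WF.potRe_numOp`, all landed) whose EXCHANGE term `N·Re(exchCoef)` is kept and bounded below by an
elementary slot-0 mean/fluctuation split, `N·Re E ≥ v̂(p)n₀/L³ − ‖v‖₁(N−n₀)/L³`; the condensate fraction `n₀ ≥ 7N/8` comes
from X by mode counting; X's own `n_k ≤ C_X√ρL/‖k‖` then closes the shares with `C = max(1/π², 8C_X²/‖v‖₁)`.

Contents: §1 `potCos` (cosine transform of the periodised potential), `ChanPairZero` (both channel inequalities on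
momentum-zero near-minimisers with thresholds `E₀ ± μ` chosen PER STATE, guard `−A ≤ μ₊`, coupling `μ₋ ≤ μ₊ + e`),
`FloatingPairLow`, the pooled stub S1₁ `FloatingPairTwoChannel`; §2 stub statements — S4₁ `KLSNearMinimiserPair`, S5₁
`WindowAssemblyPair` (the endgame per state), S11a `ExchangeCondensateBound`, S11e `PotCosLowerBound`, S11b `FsumLowerBound`,
S11c `CondensateFractionOfIR`, S11d₁ `PairSharesReal` (pure real algebra), S11d₂ `SoftLocationOf`; §3 glue: S1₀ ⇒ S1₁,
`integrableHalf_of_floatingPair` (S1₁ ∧ S4₁ ∧ S5₁ ⇒ X_int), `floatingPair_of_integrableHalf` (S11* ∧ S9' ⇒ (X_int ⇒ S1₁)),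
and the equivalence `floatingPairTwoChannel_iff_integrableHalf` modulo the stubs. Statements of a proof plan, not results in
print (KLS, J. Stat. Phys. 53 (1988) 1019, (12)–(14); H. Wagner, Z. Phys. 195 (1966) 273; LSSY2005 §1.2 mode counting).
-/

noncomputable section

open scoped BigOperators ENNReal ComplexConjugate
open Filter MeasureTheory

namespace Summit.AtomisticToContinuum.BoseEinsteinCondensation.Cruxes.PeriodicIRBound.TwoSectorGdTransfer

open Literature.MathematicalPhysics.QuantumManyBody.BoseGas
open Summit.AtomisticToContinuum.BoseEinsteinCondensation.Theses.BECGroundStateSOS (PeriodicIRBound)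
open Summit.AtomisticToContinuum.BoseEinsteinCondensation.Theorems.PeriodicIRBound.Negative
  (IRBoundFor IRBoundWith NearMin InWindow IRIneq irBoundFor_iff periodicIRBound_iff_split)
open Summit.AtomisticToContinuum.BoseEinsteinCondensation.Cruxes.PeriodicIRBound.LinearPhFloorWagner
  (WF.qform WF.normSq WF.IsCore WF.exchCoef WF.wL1)

/-! ## §1 The per-state floating bound -/

/-- **The cosine transform of the periodised potential at `p`**: `v̂_L(p) = ∫_{[0,L)³} v^per(z) cos(p·z) dz` (for a
dual-lattice `p = 2πk/L` this equals `∫_{ℝ³} v(|z|)cos(p·z)dz`, real and even); it is the eigenvalue of convolution by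
`v^per` on the plane wave `e^{ip·x}`. [folklore] -/
def potCos (w : ℝ → ℝ≥0∞) (L : ℝ) (p : Space) : ℝ :=
  ∫ z in cell L, (periodizedPotential w L z).toReal * Real.cos (∑ j, p j * z j)

/-- **Both KLS channel inequalities on momentum-zero near-minimisers with a PER-STATE floating chemical potential**
(bound `b`, guard `−A ≤ μ₊`, coupling `μ₋ ≤ μ₊ + e`): for every `η > 0` there is `δ > 0` such that every momentum-zero
`δ`-near-minimiser `Ψ` of `H_{m+2}` admits `μ₊, μ₋` with the particle channel against `E₀ + μ₊` and the hole channel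
against `E₀ − μ₋`. `ChanPlusZero … (E₀+μ₊) b ∧ ChanMinusZero … (E₀−μ₋) b` (v9, `μ` chosen before `Ψ`) implies it
(`chanPairZero_of_chans`). [cite: KLS1988JSP, (12)] -/
def ChanPairZero (v : ℝ → ℝ≥0∞) (m : ℕ) (L : ℝ) (n : Fin 3 → ℤ) (b A e : ℝ) : Prop :=
  ∀ η : ℝ, 0 < η → ∃ δ : ℝ≥0∞, 0 < δ ∧ ∀ Ψ : PeriodicTrialState (m + 2) L, NearMinAt v δ Ψ →
    HasTotalMomentum 0 Ψ.ψ →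
      let e0 : ℝ := (periodicGroundStateEnergy v (m + 2) L).toReal
      let nk : ℝ := (cellOccupation (m + 2) L (planeWaveMode L n) Ψ.ψ).toReal
      let qC : ℝ := (WF.qform v L (modeCr (planeWaveMode L n) Ψ.ψ)).toReal
      let qA : ℝ := (WF.qform v L (modeAn L (planeWaveMode L n) Ψ.ψ)).toReal
      ∃ μp μm : ℝ, -A ≤ μp ∧ μm ≤ μp + e ∧
        (nk + 1) ^ 2 ≤ b * ((1 + η) * (qC - (e0 + μp) * (nk + 1)) + η * (nk + 1)) ∧
        nk ^ 2 ≤ b * ((1 + η) * (qA - (e0 - μm) * nk) + η * nk)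

/-- **The per-state floating two-channel bound, low-momentum window, for ONE potential with data `(K, ρ₀, C, A)`**: as
`FloatingForLow v K ρ₀ C A` (v9) with the chemical potentials chosen per state. A statement of the proof plan, not a result
in print. -/
def FloatingPairLow (v : ℝ → ℝ≥0∞) (K ρ₀ C A : ℝ) : Prop :=
  ∀ ε : ℝ, 0 < ε → ∀ ρ : ℝ, 0 < ρ → ρ < ρ₀ → ∀ᶠ m : ℕ in atTop,
    ∀ n : Fin 3 → ℤ, n ≠ 0 → 2 * Real.pi / sideLength ρ (m + 2) * ‖(fun j => (n j : ℝ))‖ ≤ K * Real.sqrt ρ →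
      ChanPairZero v m (sideLength ρ (m + 2)) n (C * sideLength ρ (m + 2) ^ 2 / ‖(fun j => (n j : ℝ))‖ ^ 2) (A * ρ)
        (ε * Real.sqrt (ρ * (scatteringLength v).toReal) / sideLength ρ (m + 2))

/-- **Stub S1₁ statement — the pooled load of the v11 skeleton**: every integrable admissible `v` admits, for every
`K > 0`, data `ρ₀, C > 0`, `A ≥ 0` with `FloatingPairLow v K ρ₀ C A`. Implied by S1₀ `FloatingTwoChannelLow`
(`floatingPairTwoChannel_of_floatingTwoChannelLow`), hence by S1', by stmt-12620 ∧ stmt-9094 and by `C⁺`; implies the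
integrable half of the crux (modulo S4₁, S5₁) AND IS IMPLIED BY IT (modulo S11a–e, SOFT-LOCATION.md): S1₁ ⟺ X_int. A statement
of the proof plan, not a result in print. -/
def FloatingPairTwoChannel : Prop :=
  ∀ v : ℝ → ℝ≥0∞, IsRepulsiveFiniteRange v → (∫⁻ x : Space, v ‖x‖) ≠ ⊤ →
    ∀ K : ℝ, 0 < K → ∃ ρ₀ : ℝ, 0 < ρ₀ ∧ ∃ C : ℝ, 0 < C ∧ ∃ A : ℝ, 0 ≤ A ∧ FloatingPairLow v K ρ₀ C A

/-! ## §2 Statements of the v11 stubs -/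

/-- **The KLS moment inequality from the per-state channels, for ONE potential** (S4₁ per `v`): as `KLSMomentForTZero v`
(v9) with the hypothesis `ChanPairZero v m L n b A e` and the conclusion carrying the per-state `μ₊, μ₋` (thresholds
`Tp = E₀ + μ₊`, `Tm = E₀ − μ₋`). Plan: `KLSZero.klsMomentForTZero` (p160279) verbatim, `μ₊, μ₋` obtained per state before
`KLS.real_core`. [cite: KLS1988JSP, (12)–(14); Wagner1966, §2] -/
def KLSMomentPair (v : ℝ → ℝ≥0∞) : Prop :=
  ∀ (m : ℕ) (L : ℝ), 0 < L → periodicGroundStateEnergy v (m + 2) L ≠ ⊤ →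
    ∀ n : Fin 3 → ℤ, n ≠ 0 → ∀ b A e : ℝ, 0 ≤ b → ChanPairZero v m L n b A e →
      ∀ η : ℝ, 0 < η → ∃ δ : ℝ≥0∞, 0 < δ ∧ ∀ Ψ : PeriodicTrialState (m + 2) L, NearMinAt v δ Ψ →
        HasTotalMomentum 0 Ψ.ψ →
          let e0 : ℝ := (periodicGroundStateEnergy v (m + 2) L).toReal
          let nk : ℝ := (cellOccupation (m + 2) L (planeWaveMode L n) Ψ.ψ).toReal
          ∃ μp μm : ℝ, -A ≤ μp ∧ μm ≤ μp + e ∧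
            (2 * nk + 1) ^ 2 ≤
              2 * b * ((1 + η) * (‖latticeVec (2 * Real.pi / L) n‖ ^ 2 +
                  2 * ((m : ℝ) + 2) * (∫⁻ x : Space, v ‖x‖).toReal / L ^ 3 +
                  e0 * (2 * nk + 1) - (e0 - μm) * nk - (e0 + μp) * (nk + 1)) +
                η * (2 * nk + 2))

/-- **Stub S4₁ statement**: `KLSMomentPair v` for every integrable admissible `v` (provable now). -/
def KLSNearMinimiserPair : Prop :=
  ∀ v : ℝ → ℝ≥0∞, IsRepulsiveFiniteRange v → (∫⁻ x : Space, v ‖x‖) ≠ ⊤ → KLSMomentPair v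

/-- **Stub S5₁ statement — the window endgame per state**: for an integrable admissible `v` and `κ > 0`,
`FloatingPairLow v (2πκ) ρ₀ C A` and `KLSMomentPair v` give `IRBoundZeroWith v κ ρ₀ C'` for some `C' > 0`. Plan:
`stub_windowAssemblyTLow` (p160319) verbatim with `μ₊, μ₋` obtained per state before `WindowArithLow.nk_le`
(`hmono : e0 ≤ (e0+μ₊) + Aρ`, `hconv : μ₋ ≤ μ₊ + e`). A statement of the proof plan, not a result in print. -/
def WindowAssemblyPair : Prop :=
  ∀ v : ℝ → ℝ≥0∞, IsRepulsiveFiniteRange v → (∫⁻ x : Space, v ‖x‖) ≠ ⊤ →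
    ∀ κ ρ₀ C A : ℝ, 0 < κ → 0 < ρ₀ → 0 < C → 0 ≤ A →
      FloatingPairLow v (2 * Real.pi * κ) ρ₀ C A → KLSMomentPair v → ∃ C' : ℝ, 0 < C' ∧ IRBoundZeroWith v κ ρ₀ C'

/-- **Stub S11a statement — the exchange coefficient is condensate-dominated (ELEMENTARY, SOFT-LOCATION.md Step 3).** For
measurable `w` with `∫ w(|x|)dx < ∞`, `L > 0`, a mode `k` and a core `(m+1)`-body `Φ`, with `n₀(Φ) = ‖a_0Φ‖²`
(`cellOccupation … (planeWaveMode L 0) Φ`) and `p = 2πk/L`: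
`(m+1)·Re E_Φ ≥ v̂_L(p)·n₀/L³ − ‖w‖₁·((m+1)‖Φ‖² − n₀)/L³`, `E_Φ = WF.exchCoef w L k Φ`. Plan: Fubini
`E = ∫_{W'} Q(g_{W'})`, `g_{W'}(x) = conj φ_k(x)·Φ(x::W')`, `Q(g) = ∫∫ w^per(x−y) g(x) conj g(y)`; split slot 0 into mean and
fluctuation `Φ(x::W') = φ_0(x)c(W') + Φ'`, `c = sliceCoef L 0 Φ` (`∫_x Φ' = 0`); `Q(g₁) = |c|²v̂_L(p)/L³` (the plane wave is
an eigenfunction of convolution: `∫_x w^per(x−y)e^{-ip·x}dx = e^{-ip·y}v̂_L(p)` by `L`-periodicity and `p` dual);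
the cross term VANISHES (`∫Φ' = 0`); `|Q(g₂)| ≤ ‖w‖₁‖g₂‖²₂ = ‖w‖₁L⁻³∫|Φ'|²` (Schur: `|g(x)||g(y)| ≤ (|g(x)|²+|g(y)|²)/2`,
`∫_{cell} w^per = ‖w‖₁`); finally `(m+1)∫|c|² = n₀` (`WF.sliceCoef_eq_modeAn`, `WF.normSq_modeAn`) and
`(m+1)∫∫|Φ'|² = (m+1)‖Φ‖² − n₀`. Provable now (toolkit: `…WFPotToolkit`, `…WFPotCreate*`, `…WFHeartKin`). -/
def ExchangeCondensateBound : Prop :=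
  ∀ w : ℝ → ℝ≥0∞, Measurable w → (∫⁻ x : Space, w ‖x‖) ≠ ⊤ → ∀ (m : ℕ) (L : ℝ), 0 < L → ∀ (k : Fin 3 → ℤ)
    (Φ : Config (m + 1) → ℂ), WF.IsCore L Φ →
      potCos w L (latticeVec (2 * Real.pi / L) k) * (cellOccupation (m + 1) L (planeWaveMode L 0) Φ).toReal / L ^ 3 -
          WF.wL1 w * (((m : ℝ) + 1) * (WF.normSq L Φ).toReal -
            (cellOccupation (m + 1) L (planeWaveMode L 0) Φ).toReal) / L ^ 3 ≤
        ((m : ℝ) + 1) * (WF.exchCoef w L k Φ).re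

/-- **Stub S11e statement — the cosine transform on the window**: for measurable `w ≥ 0` of range `R`
(`w(r) = 0` for `r > R`), `L > 0` and a dual-lattice `p = 2πk/L`: `v̂_L(p) ≥ ‖w‖₁(1 − ‖p‖R)`. Plan: unfold the
periodisation (`∫_{cell} w^per(z)f(z)dz = ∫_{ℝ³} w(|z|)f(z)dz` for `Lℤ³`-periodic `f ≥ 0`, applied to `cos⁺(p·z)` and
`cos⁻(p·z)`), then `cos t ≥ 1 − |t|` and `|p·z| ≤ ‖p‖‖z‖ ≤ ‖p‖R` on the support. Provable now. -/
def PotCosLowerBound : Prop :=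
  ∀ w : ℝ → ℝ≥0∞, Measurable w → (∫⁻ x : Space, w ‖x‖) ≠ ⊤ → ∀ R : ℝ, 0 < R → (∀ r : ℝ, R < r → w r = 0) →
    ∀ L : ℝ, 0 < L → ∀ k : Fin 3 → ℤ,
      WF.wL1 w * (1 - ‖latticeVec (2 * Real.pi / L) k‖ * R) ≤ potCos w L (latticeVec (2 * Real.pi / L) k)

/-- **Stub S11b statement — the two-sided f-sum at near-minimisers with the exchange kept (SOFT-LOCATION.md Step 2).**
For an integrable admissible `v`, fixed `(N, L) = (m+2, L)` with `E₀ < ⊤`, a mode `n ≠ 0`: for every `η > 0` there is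
`δ > 0` such that every `δ`-near-minimiser `Ψ` (any momentum) obeys
`𝓔[aψ] + 𝓔[a†ψ] − E₀(2n_k+1) ≥ ‖p‖² + N‖v‖₁/L³ + N·Re E_ψ − η`. Plan: the IDENTITY behind the landed
`WF.wagnerFeynman_form_le` (`WF.kinetic_wagnerFeynman`; `WF.potForm_modeCr` = `P[a†Φ] = P[Φ] + N‖v‖₁/L³‖Φ‖² + P[aΦ] +
2N∑_b Re s_b + N Re E`; `WF.potRe_numOp`; `WF.formRe_eq_formRe_zero_add_potRe`) gives
`𝓔[aψ] + 𝓔[a†ψ] = (‖p‖² + N‖v‖₁/L³)‖ψ‖² + 𝓔[ψ] + 2Re B_v(ψ, N̂ψ) + N Re E_ψ` exactly; then `𝓔[ψ] ≥ E₀` and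
`|Re B_v(ψ, N̂ψ) − E₀ n_k| ≤ √δ√K` (`WF.abs_formRe_sub_le`, `K ≤ Kb` as in `KLS.klsMomentForT`, slack `δ₀(η, Kb)` by
`KLS.exists_slack`-type choice). Provable now. -/
def FsumLowerBound : Prop :=
  ∀ v : ℝ → ℝ≥0∞, IsRepulsiveFiniteRange v → (∫⁻ x : Space, v ‖x‖) ≠ ⊤ →
    ∀ (m : ℕ) (L : ℝ), 0 < L → periodicGroundStateEnergy v (m + 2) L ≠ ⊤ → ∀ n : Fin 3 → ℤ, n ≠ 0 →
      ∀ η : ℝ, 0 < η → ∃ δ : ℝ≥0∞, 0 < δ ∧ ∀ Ψ : PeriodicTrialState (m + 2) L, NearMinAt v δ Ψ →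
        let e0 : ℝ := (periodicGroundStateEnergy v (m + 2) L).toReal
        let nk : ℝ := (cellOccupation (m + 2) L (planeWaveMode L n) Ψ.ψ).toReal
        let qC : ℝ := (WF.qform v L (modeCr (planeWaveMode L n) Ψ.ψ)).toReal
        let qA : ℝ := (WF.qform v L (modeAn L (planeWaveMode L n) Ψ.ψ)).toReal
        ‖latticeVec (2 * Real.pi / L) n‖ ^ 2 + ((m : ℝ) + 2) * WF.wL1 v / L ^ 3 +
            ((m : ℝ) + 2) * (WF.exchCoef v L n Ψ.ψ).re - η ≤
          qA + qC - e0 * (2 * nk + 1)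

/-- **Stub S11c statement — condensate fraction `7/8` from the infrared bound, per potential (SOFT-LOCATION.md Step 4).**
For an admissible `v`, `IRBoundFor v` gives `ρ₀ > 0` such that for `ρ < ρ₀`, eventually in `N`, some slack `δ > 0` makes
every `δ`-near-minimiser on the torus `L_N(ρ)` have `n_0 ≥ 7N/8`. Plan: `IRModeCounting_proof`
(Theorems/BECGroundStateSOSIRModeCounting.lean) run per `v` with margins `N/16` instead of `N/4` (the counting lemma
`condensate_ge_half` generalised to arbitrary margins: Parseval `N = ∑ n_k ≤ n₀ + ∑_{IR} C/‖k‖ + D⁻¹⟨Ψ,TΨ⟩`, the LSSY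
upper bound `LSSY2005_upperBound_periodic_holds`, `κ` and `ρ₀` shrunk accordingly); `condensateOccupation` is the
occupation of `planeWaveMode L 0`. Provable now (mode counting after LSSY2005 §1.2 (1.17)–(1.19); a statement of the proof
plan, not a result in print). -/
def CondensateFractionOfIR : Prop :=
  ∀ v : ℝ → ℝ≥0∞, IsRepulsiveFiniteRange v → IRBoundFor v → ∃ ρ₀ : ℝ, 0 < ρ₀ ∧ ∀ ρ : ℝ, 0 < ρ → ρ < ρ₀ →
    ∀ᶠ N : ℕ in atTop, ∃ δ : ℝ≥0∞, 0 < δ ∧ ∀ Ψ : PeriodicTrialState N (sideLength ρ N), NearMin v ρ N δ Ψ →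
      ENNReal.ofReal (7 / 8 * (N : ℝ)) ≤ cellOccupation N (sideLength ρ N) (planeWaveMode (sideLength ρ N) 0) Ψ.ψ

/-- **Stub S11d₁ statement — the per-state shares from an f-sum gap (pure real algebra, SOFT-LOCATION.md Steps 1 and 5).**
Reals: occupation `0 ≤ nk ≤ Bm`, energies `qA, qC` of the hole/particle test vectors, `e0 = E₀(N)`, `e0m = E₀(N−1)`,
`e0p = E₀(N+1)` with the variational bounds `e0m·nk ≤ qA`, `e0p(nk+1) ≤ qC`, `e0 ≤ e0p`, an f-sum lower bound
`Fl ≤ qA + qC − e0(2nk+1)` and the NUMERIC GAP `(Bm+1)(2Bm+1) ≤ b(Fl − (e0 − e0m))`. Conclusion: some `μ ≥ −(Bm+1)/b`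
carries both `η`-regularised shares against `e0 ± μ`. Proof: with `P = qC − e0(nk+1) ≥ 0`, `M = qA − e0·nk ≥ −(e0−e0m)nk`,
`F = P + M ≥ Fl`: `nk·F + M ≥ nk(Fl − (e0−e0m)) ≥ nk(nk+1)(2nk+1)/b`, which is exactly the solvability of
`nk/b − M/nk ≤ μ ≤ P/(nk+1) − (nk+1)/b` (`nk > 0`; for `nk = 0` take `μ = P − 1/b`); take
`μ := max(nk/b − M/nk, −(Bm+1)/b)` (the upper end is `≥ −(nk+1)/b`). Provable now (nlinarith). -/
def PairSharesReal : Prop :=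
  ∀ nk qA qC e0 e0m e0p b Bm Fl η : ℝ, 0 < b → 0 ≤ nk → nk ≤ Bm → 0 < η →
    e0m * nk ≤ qA → e0p * (nk + 1) ≤ qC → e0 ≤ e0p → Fl ≤ qA + qC - e0 * (2 * nk + 1) →
    (Bm + 1) * (2 * Bm + 1) ≤ b * (Fl - (e0 - e0m)) →
      ∃ μ : ℝ, -((Bm + 1) / b) ≤ μ ∧
        (nk + 1) ^ 2 ≤ b * ((1 + η) * (qC - (e0 + μ) * (nk + 1)) + η * (nk + 1)) ∧
        nk ^ 2 ≤ b * ((1 + η) * (qA - (e0 - μ) * nk) + η * nk)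

/-- **The soft-location arrow, per potential**: for an integrable admissible `v` with `∫v ≠ 0`, `IRBoundFor v` gives, for
every `K > 0`, data with `FloatingPairLow v K ρ₀ C A`. -/
def SoftLocation : Prop :=
  ∀ v : ℝ → ℝ≥0∞, IsRepulsiveFiniteRange v → (∫⁻ x : Space, v ‖x‖) ≠ ⊤ → (∫⁻ x : Space, v ‖x‖) ≠ 0 →
    IRBoundFor v → ∀ K : ℝ, 0 < K → ∃ ρ₀ : ℝ, 0 < ρ₀ ∧ ∃ C : ℝ, 0 < C ∧ ∃ A : ℝ, 0 ≤ A ∧ FloatingPairLow v K ρ₀ C A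

/-- **Stub S11d₂ statement — the assembly of the soft-location arrow from S11a, S11e, S11b, S11c, S11d₁** (filters and
window arithmetic; SOFT-LOCATION.md Steps 4–5). Plan: fix `K`, `κ := K/(2π)`; from `IRBoundFor v` at `κ`: `ρX, C_X` and a
slack `δ_X` with `n_k ≤ Bm := C_X√ρL/‖n‖_∞` on the window (`InWindow κ`, = the low window); from S11c: `n₀ ≥ 7N/8` at slack
`δ_B`; range `R` of `v` (`exists_pos_range`) and S11e: `v̂_L(p) ≥ (3/4)‖v‖₁` once `2π√3κ√ρR ≤ 1/4`; S11a + S11b (at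
`η' := ρ‖v‖₁/8`): `Fl := ‖p‖² + N‖v‖₁/L³ + [v̂_L(p)n₀ − ‖v‖₁(N−n₀)]/L³ − η' ≥ ‖p‖² + (N+1)‖v‖₁/L³·… `; Born
(`PuffFloorRemovalEnergy.periodicGroundStateEnergy_succ_le`: `E₀(m+2) ≤ E₀(m+1) + (m+1)(ofReal L³)⁻¹∫v`) gives
`e0 − e0m ≤ (m+1)‖v‖₁/L³`, so `Fl − (e0−e0m) ≥ 4π²‖n‖²/L² + ρ‖v‖₁/4`; constants `C := max (1/π²) (16C_X²/‖v‖₁) + 1`,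
`b := CL²/‖n‖²`, check `(Bm+1)(2Bm+1) ≤ 4C_X²ρL²/‖n‖² + … ≤ b(Fl − (e0−e0m))` and `(Bm+1)/b ≤ Aρ` with
`A := κ(C_X+κ)/C` (as `FloorArrow.B_add_one_div_le`, p160612); the variational inputs of S11d₁ are
`WF.periodicGroundStateEnergy_mul_normSq_le`-type bounds at `m+1` (hole test vector, `WF.normSq_modeAn`) and `m+3`
(particle test vector, `WF.normSq_modeCr`, monotonicity `WF.periodicGroundStateEnergy_le_succ`), finite thanks to
`periodicGroundStateEnergy_ne_top_of_lintegral_ne_top`; the least slack `min δ_X δ_B δ_F` works; `μ₊ = μ₋ = μ` (coupling slack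
`ε√(ρa)/L ≥ 0` unused). Provable now (template: `…TwoSectorLinearFloorArrow.lean`). -/
def SoftLocationOf : Prop :=
  ExchangeCondensateBound → PotCosLowerBound → FsumLowerBound → CondensateFractionOfIR → PairSharesReal → SoftLocation

/-! ## §3 Sorry-free glue -/

/-- Uniform chemical potentials are per-state chemical potentials: the v9 channel pair implies `ChanPairZero`. [folklore] -/
theorem chanPairZero_of_chans {v : ℝ → ℝ≥0∞} {m : ℕ} {L : ℝ} {n : Fin 3 → ℤ} {b A e μp μm : ℝ}
    (hμp : -A ≤ μp) (hμm : μm ≤ μp + e)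
    (hP : ChanPlusZero v m L n ((periodicGroundStateEnergy v (m + 2) L).toReal + μp) b)
    (hM : ChanMinusZero v m L n ((periodicGroundStateEnergy v (m + 2) L).toReal - μm) b) :
    ChanPairZero v m L n b A e := by
  intro η hη
  obtain ⟨δ₁, hδ₁, h₁⟩ := hP η hη
  obtain ⟨δ₂, hδ₂, h₂⟩ := hM η hη
  refine ⟨min δ₁ δ₂, lt_min hδ₁ hδ₂, fun Ψ hΨ h0 => ?_⟩
  have k₁ := h₁ Ψ (hΨ.trans (add_le_add le_rfl (min_le_left _ _))) h0
  have k₂ := h₂ Ψ (hΨ.trans (add_le_add le_rfl (min_le_right _ _))) h0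
  simp only at k₁ k₂ ⊢
  exact ⟨μp, μm, hμp, hμm, k₁, k₂⟩

/-- **S1₀-data ⇒ S1₁-data, per potential.** [folklore] -/
theorem floatingPairLow_of_floatingForLow {v : ℝ → ℝ≥0∞} {K ρ₀ C A : ℝ} (h : FloatingForLow v K ρ₀ C A) :
    FloatingPairLow v K ρ₀ C A := by
  intro ε hε ρ hρ hρρ₀
  filter_upwards [h ε hε ρ hρ hρρ₀] with m hm n hn hwin
  obtain ⟨μp, μm, hμp, hμm, hP, hM⟩ := hm n hn hwin
  exact chanPairZero_of_chans hμp hμm hP hM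

/-- **S1₀ ⇒ S1₁.** [folklore] -/
theorem floatingPairTwoChannel_of_floatingTwoChannelLow (h : FloatingTwoChannelLow) : FloatingPairTwoChannel := by
  intro v hv hint K hK
  obtain ⟨ρ₀, hρ₀, C, hC, A, hA, hF⟩ := h v hv hint K hK
  exact ⟨ρ₀, hρ₀, C, hC, A, hA, floatingPairLow_of_floatingForLow hF⟩

/-- **The a.e.-free potentials carry S1₁-data** (landed S9' p160400 + restriction). [folklore] -/
theorem floatingPairLow_of_lintegral_eq_zero {v : ℝ → ℝ≥0∞} (hv : IsRepulsiveFiniteRange v)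
    (h0 : (∫⁻ x : Space, v ‖x‖) = 0) {K : ℝ} (hK : 0 < K) :
    ∃ ρ₀ : ℝ, 0 < ρ₀ ∧ ∃ C : ℝ, 0 < C ∧ ∃ A : ℝ, 0 ≤ A ∧ FloatingPairLow v K ρ₀ C A := by
  obtain ⟨ρ₀, hρ₀, C, hC, A, hA, hF⟩ := stub_aeZeroFloatingLow v hv h0 K hK
  exact ⟨ρ₀, hρ₀, C, hC, A, hA, floatingPairLow_of_floatingForLow hF⟩

/-- **From the per-state floating bound to the momentum-zero infrared bound, per potential** (S4₁-output and S5₁ as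
hypotheses). [folklore] -/
theorem irBoundForZero_of_floatingPair {v : ℝ → ℝ≥0∞} (hv : IsRepulsiveFiniteRange v)
    (hint : (∫⁻ x : Space, v ‖x‖) ≠ ⊤)
    (hF : ∀ K : ℝ, 0 < K → ∃ ρ₀ : ℝ, 0 < ρ₀ ∧ ∃ C : ℝ, 0 < C ∧ ∃ A : ℝ, 0 ≤ A ∧ FloatingPairLow v K ρ₀ C A)
    (h4 : KLSMomentPair v) (h5 : WindowAssemblyPair) : IRBoundForZero v := by
  intro κ hκ
  obtain ⟨ρ₀, hρ₀, C, hC, A, hA, hFK⟩ := hF (2 * Real.pi * κ) (by positivity)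
  obtain ⟨C', hC', hIR⟩ := h5 v hv hint κ ρ₀ C A hκ hρ₀ hC hA hFK h4
  exact ⟨ρ₀, hρ₀, C', hC', hIR⟩

/-- **S1₁ ∧ S4₁ ∧ S5₁ ⇒ the integrable half of the crux.** [folklore] -/
theorem integrableHalf_of_floatingPair (h1 : FloatingPairTwoChannel) (h4 : KLSNearMinimiserPair)
    (h5 : WindowAssemblyPair) :
    ∀ v : ℝ → ℝ≥0∞, IsRepulsiveFiniteRange v → (∫⁻ x : Space, v ‖x‖) ≠ ⊤ → IRBoundFor v :=
  fun v hv hint => irBoundFor_of_irBoundForZero hv hint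
    (irBoundForZero_of_floatingPair hv hint (h1 v hv hint) (h4 v hv hint) h5)

/-- **Registered by-product `stub_integrableHalfOfFloatingPair` of the crux ledger** (v11): S1₁ ∧ S4₁ ∧ S5₁ give
`IRBoundFor v` for every INTEGRABLE admissible `v`. [folklore] -/
theorem stub_integrableHalfOfFloatingPair :
    FloatingPairTwoChannel → KLSNearMinimiserPair → WindowAssemblyPair →
      ∀ v : ℝ → ℝ≥0∞, IsRepulsiveFiniteRange v → (∫⁻ x : Space, v ‖x‖) ≠ ⊤ → IRBoundFor v :=
  integrableHalf_of_floatingPair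

/-- **`PeriodicIRBound` by name from S1₁, S4₁, S5₁ and S6.** [folklore] -/
theorem periodicIRBound_of_floatingPair (h1 : FloatingPairTwoChannel) (h4 : KLSNearMinimiserPair)
    (h5 : WindowAssemblyPair) (h6 : NonIntegrableHalf) : PeriodicIRBound :=
  periodicIRBound_iff_split.2 ⟨integrableHalf_of_floatingPair h1 h4 h5, h6⟩

/-- **THE CONVERSE: the integrable half of the crux implies S1₁** (modulo the soft-location stubs S11a–e; the
a.e.-free potentials by the landed S9'). [folklore] -/
theorem floatingPair_of_integrableHalf (h11a : ExchangeCondensateBound) (h11e : PotCosLowerBound)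
    (h11b : FsumLowerBound) (h11c : CondensateFractionOfIR) (h11d₁ : PairSharesReal) (h11d₂ : SoftLocationOf)
    (hX : ∀ v : ℝ → ℝ≥0∞, IsRepulsiveFiniteRange v → (∫⁻ x : Space, v ‖x‖) ≠ ⊤ → IRBoundFor v) :
    FloatingPairTwoChannel := by
  intro v hv hint K hK
  by_cases h0 : (∫⁻ x : Space, v ‖x‖) = 0
  · exact floatingPairLow_of_lintegral_eq_zero hv h0 hK
  · exact h11d₂ h11a h11e h11b h11c h11d₁ v hv hint h0 (hX v hv hint) K hK

/-- **THE EQUIVALENCE modulo the v11 stubs**: S1₁ `FloatingPairTwoChannel` ⟺ the integrable half of `PeriodicIRBound`.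
[folklore] -/
theorem floatingPairTwoChannel_iff_integrableHalf (h4 : KLSNearMinimiserPair) (h5 : WindowAssemblyPair)
    (h11a : ExchangeCondensateBound) (h11e : PotCosLowerBound) (h11b : FsumLowerBound)
    (h11c : CondensateFractionOfIR) (h11d₁ : PairSharesReal) (h11d₂ : SoftLocationOf) :
    FloatingPairTwoChannel ↔
      ∀ v : ℝ → ℝ≥0∞, IsRepulsiveFiniteRange v → (∫⁻ x : Space, v ‖x‖) ≠ ⊤ → IRBoundFor v :=
  ⟨fun h1 => integrableHalf_of_floatingPair h1 h4 h5,
    floatingPair_of_integrableHalf h11a h11e h11b h11c h11d₁ h11d₂⟩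

end Summit.AtomisticToContinuum.BoseEinsteinCondensation.Cruxes.PeriodicIRBound.TwoSectorGdTransfer

end
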